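import Literature.AlgebraicGeometry.Resolution.ResolutionLU
import Literature.AlgebraicGeometry.Resolution.DivisorialPlace
import Literature.AlgebraicGeometry.Resolution.FieldsJ2
import Literature.AlgebraicGeometry.Resolution.AffineModelLU
import HarnessLib

/-!
# A regular affine chart inside a valuation ring (crux `PurityTransfer`, line `birth`)

Stub `stub_regularChart` of the skeleton `birth` for crux stmt-ResolutionOfSingularities-17142
(`Summit.ResolutionOfSingularities.ResolutionOfSingularities.Theses.WildPurity.PurityTransfer`).

For fields `k ⊆ K`, a valuation ring `O` of `K` and a finitely generated `k`-subalgebra `A ⊆ O`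
with `Frac A = K` whose localisation at the centre `𝔮 = 𝔪_O ∩ A` is a regular local ring, there
is a finitely generated `k`-subalgebra `A ⊆ A' ⊆ O` all of whose localisations at primes are regular.

Proof (Matsumura, §30, Cor. to Thm. 30.5): fields are J-2, so the regular locus `Reg(A)` is open
(`isOpen_regularLocus_of_finiteType_field`); it contains `𝔮`, hence a basic open `D(f) ∋ 𝔮`,
i.e. `f ∉ 𝔮`, so `f` is a unit of `O` (`inv_mem_of_notMem_centreIdeal`).  Put `A' := A[1/f]`
(`= k[s, 1/f]` for a finite generating set `s` of `A`): it is finitely generated, contains `A` and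
sits inside `O`.  Every prime `P` of `A'` misses the unit `f`, so `P ∩ A ∈ D(f) ⊆ Reg(A)`, and
`A'_P = A_{P ∩ A}` inside `K` because every element of `A'` becomes an element of `A` after
multiplication by a power of `f` (`isRegularLocalRing_localization_of_sandwich`).
-/

noncomputable section

-- single-problem summit: the doubled namespace component `ResolutionOfSingularities` is forced
set_option linter.dupNamespace false

open Literature.AlgebraicGeometry.Resolution

namespace Summit.ResolutionOfSingularities.ResolutionOfSingularities.Theorems.WildPurityPurityTransfer

/-- Denominators in `k[s, 1/f]`: if `s ⊆ A` and `0 ≠ f ∈ A` for a subalgebra `A` of a field, every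
element `x` of `k[s, 1/f]` satisfies `x * f ^ n ∈ A` for some `n`. -/
theorem exists_mul_pow_mem_of_mem_adjoin_insert_inv {k K : Type} [Field k] [Field K] [Algebra k K]
    (A : Subalgebra k K) {s : Set K} (hs : s ⊆ A) {f : K} (hfA : f ∈ A) (hf0 : f ≠ 0) {x : K}
    (hx : x ∈ Algebra.adjoin k (insert f⁻¹ s)) : ∃ n : ℕ, x * f ^ n ∈ A := by
  refine Algebra.adjoin_induction (p := fun x _ => ∃ n : ℕ, x * f ^ n ∈ A) ?_ ?_ ?_ ?_ hx
  · intro x hx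
    rcases Set.mem_insert_iff.mp hx with rfl | hx
    · exact ⟨1, by rw [pow_one, inv_mul_cancel₀ hf0]; exact one_mem A⟩
    · exact ⟨0, by rw [pow_zero, mul_one]; exact hs hx⟩
  · exact fun c => ⟨0, by rw [pow_zero, mul_one]; exact A.algebraMap_mem c⟩
  · rintro x y - - ⟨m, hm⟩ ⟨n, hn⟩
    refine ⟨m + n, ?_⟩
    have e : (x + y) * f ^ (m + n) = x * f ^ m * f ^ n + y * f ^ n * f ^ m := by ring
    rw [e]
    exact add_mem (mul_mem hm (pow_mem hfA n)) (mul_mem hn (pow_mem hfA m))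
  · rintro x y - - ⟨m, hm⟩ ⟨n, hn⟩
    refine ⟨m + n, ?_⟩
    have e : x * y * f ^ (m + n) = x * f ^ m * (y * f ^ n) := by ring
    rw [e]
    exact mul_mem hm hn

/-- **Regularity at the centre of a valuation ring spreads to an affine chart inside the valuation
ring.** For fields `k ⊆ K`, a valuation ring `O` of `K` and a finitely generated `k`-subalgebra
`A ⊆ O` with `Frac A = K` whose localisation at the centre `𝔪_O ∩ A` is a regular local ring, there
is a finitely generated `k`-subalgebra `A ⊆ A' ⊆ O` all of whose localisations at primes are regular
local rings: fields are J-2 (`isOpen_regularLocus_of_finiteType_field`), take `D(f) ∋ 𝔪_O ∩ A`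
inside `Reg(A)` and `A' = A[1/f]`, which stays inside `O` because `f` is a unit of `O`
(`inv_mem_of_notMem_centreIdeal`); `A'_P = A_{P ∩ A}` (`isRegularLocalRing_localization_of_sandwich`).
[cite: Matsumura1987, §30, Cor. to Thm. 30.5] -/
theorem stub_regularChart (k K : Type) [Field k] [Field K] [Algebra k K] (O : ValuationSubring K)
    (A : Subalgebra k K) (h : A.toSubring ≤ O.toSubring) (hfg : A.FG) (hfr : IsFractionRing A K)
    (hreg : IsRegularLocalRing (Localization.AtPrime (centreIdeal A O h))) :
    ∃ A' : Subalgebra k K, A ≤ A' ∧ A'.toSubring ≤ O.toSubring ∧ A'.FG ∧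
      ∀ (P : Ideal A') [P.IsPrime], IsRegularLocalRing (Localization.AtPrime P) := by
  classical
  haveI : Algebra.FiniteType k A := A.fg_iff_finiteType.mp hfg
  -- the regular locus of `A` is open (fields are J-2) and contains the centre `𝔮`
  have hopen : IsOpen (regularLocus A) := isOpen_regularLocus_of_finiteType_field k A
  have hmem : (⟨centreIdeal A O h, inferInstance⟩ : PrimeSpectrum A) ∈ regularLocus A := hreg
  obtain ⟨_, ⟨f, rfl⟩, hf𝔮, hfreg⟩ :=
    PrimeSpectrum.isTopologicalBasis_basic_opens.exists_subset_of_mem_open hmem hopen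
  have hDf : (PrimeSpectrum.basicOpen f : Set (PrimeSpectrum A)) ⊆ regularLocus A := hfreg
  have hf : f ∉ centreIdeal A O h := by
    have hf' : (⟨centreIdeal A O h, inferInstance⟩ : PrimeSpectrum A) ∈
        (PrimeSpectrum.basicOpen f : Set (PrimeSpectrum A)) := hf𝔮
    rwa [SetLike.mem_coe, PrimeSpectrum.mem_basicOpen] at hf'
  have hf0 : (f : K) ≠ 0 := ne_zero_of_notMem_centreIdeal O A h hf
  have hfO : (f : K)⁻¹ ∈ O := inv_mem_of_notMem_centreIdeal O A h hf
  -- the chart `A' := A[1/f] = k[s, 1/f]`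
  obtain ⟨s, hs⟩ := hfg
  have hsA : (s : Set K) ⊆ A := fun x hx => hs.le (Algebra.subset_adjoin hx)
  let A' : Subalgebra k K := Algebra.adjoin k (insert (f : K)⁻¹ (s : Set K))
  have hfA' : (f : K)⁻¹ ∈ A' := Algebra.subset_adjoin (Set.mem_insert _ _)
  have hAA' : A ≤ A' := hs.ge.trans (Algebra.adjoin_mono (Set.subset_insert _ _))
  have hA'O : A'.toSubring ≤ O.toSubring := by
    intro x hx
    refine Algebra.adjoin_induction (p := fun x _ => x ∈ O) ?_ ?_ ?_ ?_ (show x ∈ A' from hx)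
    · intro x hx
      rcases Set.mem_insert_iff.mp hx with rfl | hx
      · exact hfO
      · exact h (hsA hx)
    · exact fun c => h (A.algebraMap_mem c)
    · exact fun _ _ _ _ hx hy => add_mem hx hy
    · exact fun _ _ _ _ hx hy => mul_mem hx hy
  have hA'fg : A'.FG := ⟨insert (f : K)⁻¹ s, by rw [Finset.coe_insert]⟩
  refine ⟨A', hAA', hA'O, hA'fg, fun P _ => ?_⟩
  -- regularity at a prime `P` of `A'`: `P ∩ A ∈ D(f) ⊆ Reg(A)` and `A'_P = A_{P ∩ A}` inside `K`
  have hle : A.toSubring ≤ A'.toSubring := fun x hx => hAA' hx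
  -- `f` is a unit of `A'`, hence no power of `f` lies in `P`
  have hfP : ∀ n : ℕ, Subring.inclusion hle (f ^ n) ∉ P := by
    intro n hn
    have hfP₁ : Subring.inclusion hle f ∈ P := by
      rw [map_pow] at hn
      exact Ideal.IsPrime.mem_of_pow_mem ‹P.IsPrime› n hn
    apply ‹P.IsPrime›.ne_top
    rw [Ideal.eq_top_iff_one]
    have e : (1 : A') = Subring.inclusion hle f * ⟨(f : K)⁻¹, hfA'⟩ := by
      apply Subtype.ext
      change (1 : K) = (f : K) * (f : K)⁻¹
      rw [mul_inv_cancel₀ hf0]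
    rw [e]
    exact P.mul_mem_right _ hfP₁
  haveI : IsFractionRing A.toSubring K := hfr
  set P' : Ideal A.toSubring := P.comap (Subring.inclusion hle) with hP'
  haveI hP'p : P'.IsPrime := Ideal.IsPrime.comap _
  have hreg' : IsRegularLocalRing (Localization.AtPrime P') := by
    have hmem' : (⟨P', hP'p⟩ : PrimeSpectrum A) ∈ regularLocus A := by
      apply hDf
      rw [SetLike.mem_coe, PrimeSpectrum.mem_basicOpen]
      have h₁ := hfP 1
      rwa [pow_one] at h₁
    exact hmem'
  refine isRegularLocalRing_localization_of_sandwich hle P P' rfl (fun t => ?_) hreg'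
  obtain ⟨n, hn⟩ := exists_mul_pow_mem_of_mem_adjoin_insert_inv A hsA f.2 hf0 t.2
  exact ⟨⟨_, hn⟩, f ^ n, hfP n, by simp⟩

end Summit.ResolutionOfSingularities.ResolutionOfSingularities.Theorems.WildPurityPurityTransfer

end
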